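import Literature.Probability.Percolation.KozmaNitzanPreFKG
import HarnessLib

/-! # Crux `PercNearOneGluing.AdditiveGluing` (stmt-CriticalPhenomena-4576) — the T-form star expansion (strategy (b), exact identity)

Support file (`--supports stmt-CriticalPhenomena-4576`); no definitions, no named facts.

`μ = prodBernoulli w` on the bond configurations of `Fin n`; relays `A ∋ b`, an observer / block vertex `β ∉ A`, a designation `d ∈ A`.
The crux `AdditiveGluing` for `(β, A, b)` is (with `t = max_a μ(a ↮ b) = 1 − τ(a*)`) exactly `T_{a*}(β) ≥ 0` for the **T-functional**

  `T_d(β) := μ(β ↮ A) + μ(β ↔ b) − μ(d ↔ b)`,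

and `T_d ≤ T_{a*}` for every relay `d`.  This file proves the EXACT STAR EXPANSION of the three terms of `T_d(β)` over Kozma–Nitzan's
star events `σ_B` of `β` ("the open neighbours of `β` are exactly `B`", `KNPreFKG.starEvent`):

  `T_d(β) = Σ_{B ⊆ V∖β} μ(σ_B) · [ μ(no u ∈ B is joined off β to A) + μ(some u ∈ B is joined off β to b) − μ(d ↔ b off β, or d ↔ B ↔ b off β) ]`

(`theorem T_starExpansion`).  The bracket is the T-functional of the GLUED block `[B]` in the graph with `β` deleted, written with
`openConnIn {β}ᶜ` inside the one measure `μ` (no quotient graphs); for `B = ∅` it is `1 − μ(d ↔ b off β) ≥ 0` — the isolated corner of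
the T-form is a GAIN (in the K-form of the official line it is the loss `min_A τ_{G∖β} − τ_{G∖β}(d)`).  Grouping the `B` that contain a
relay neighbour gives the multi-edge Lemma 3 term of `…MultiEdgeLemma3.lean`; the remaining blocks are the children of the seat-b
certificate calculus (memos TFormCalculus-b.md, -v2.md on the item).  Ingredients: `KNPreFKG.real_eq_sum_inter_starEvent` (sum over the
stars), `KNPreFKG.walk_decomp` (first/last visit to `β` under `σ_B`), independence of the star of `β` from the pairs off `β`.
[cite: KozmaNitzan2024, §3.2 pp. 12–14 (proof of Thms. 4–5: "Summing over all B"), Lemma 5 (p. 13)]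
-/

namespace Summit.CriticalPhenomena.PercolationContinuityZ3.Theorems

open MeasureTheory Set
open Literature.Probability.LatticeModels (prodBernoulli)
open Literature.Probability.Percolation (BondConfig openConn openConnIn openGraph DeterminedBy determinedBy_iff)
open Literature.Probability.Percolation.KNPreFKG

noncomputable section
open Classical

section TStarExpansion

open Literature.Probability.LatticeModels Literature.Probability.Percolation

variable {n : ℕ}

/-! ### Connections under the star event `σ_B` of `β`, read off `β` -/

/-- Under `σ_B` (`β ∉ B`): `β ↔ a` (`a ≠ β`) iff some `u ∈ B` is joined to `a` off `β`. [cite: KozmaNitzan2024, Lemma 5 (p. 13)] -/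
theorem reachable_center_iff_of_starEvent {ω : BondConfig (Fin n)} {β : Fin n} {B : Finset (Fin n)}
    (hB : β ∉ B) (hσ : ω ∈ starEvent β (↑B : Set (Fin n))) {a : Fin n} (ha : a ≠ β) :
    (openGraph ω).Reachable β a ↔ ∃ u ∈ B, ω ∈ openConnIn ({β}ᶜ : Set (Fin n)) u a := by
  constructor
  · rintro ⟨p⟩
    obtain ⟨u, huB, -, hu⟩ := (walk_decomp hσ p ha).2 rfl
    exact ⟨u, Finset.mem_coe.1 huB, hu⟩
  · rintro ⟨u, huB, hu⟩
    have huβ : u ≠ β := fun h => hB (h ▸ huB)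
    have hedge : s(β, u) ∈ ω := ((mem_starEvent_iff β ↑B ω).1 hσ u huβ).2 (Finset.mem_coe.2 huB)
    exact (SimpleGraph.Adj.reachable ((openGraph_adj ω β u).2 ⟨hedge, huβ.symm⟩)).trans
      (reachable_of_openConnIn hu)

/-- Under `σ_B` (`β ∉ B`): for `x, y ≠ β`, `x ↔ y` iff `x ↔ y` off `β`, or `x` is joined off `β` to some `u ∈ B` and some `u' ∈ B` is
joined off `β` to `y` (the glued block `B ∪ {β}`). [cite: KozmaNitzan2024, Lemma 5 (p. 13)] -/
theorem reachable_iff_of_starEvent {ω : BondConfig (Fin n)} {β : Fin n} {B : Finset (Fin n)}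
    (hB : β ∉ B) (hσ : ω ∈ starEvent β (↑B : Set (Fin n))) {x y : Fin n} (hx : x ≠ β) (hy : y ≠ β) :
    (openGraph ω).Reachable x y ↔
      ω ∈ openConnIn ({β}ᶜ : Set (Fin n)) x y ∨
        ((∃ u ∈ B, ω ∈ openConnIn ({β}ᶜ : Set (Fin n)) x u) ∧ ∃ u ∈ B, ω ∈ openConnIn ({β}ᶜ : Set (Fin n)) u y) := by
  constructor
  · rintro ⟨p⟩
    rcases (walk_decomp hσ p hy).1 hx with h | ⟨⟨u, huB, -, hu⟩, ⟨u', hu'B, -, hu'⟩⟩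
    · exact Or.inl h
    · exact Or.inr ⟨⟨u, Finset.mem_coe.1 huB, hu⟩, ⟨u', Finset.mem_coe.1 hu'B, hu'⟩⟩
  · rintro (h | ⟨⟨u, huB, hu⟩, ⟨u', hu'B, hu'⟩⟩)
    · exact reachable_of_openConnIn h
    · have huβ : u ≠ β := fun h => hB (h ▸ huB)
      have h1 : (openGraph ω).Reachable β u :=
        (reachable_center_iff_of_starEvent hB hσ huβ).2
          ⟨u, huB, openConnIn_rfl (mem_compl_singleton_iff.2 huβ) ω⟩
      have h2 : (openGraph ω).Reachable β y :=
        (reachable_center_iff_of_starEvent hB hσ hy).2 ⟨u', hu'B, hu'⟩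
      exact ((reachable_of_openConnIn hu).trans h1.symm).trans h2

/-! ### Independence of the star of `β` from the pairs off `β` -/

/-- `{x ↔ y off β}` is determined by the pairs not containing `β`. [folklore; Grimmett 1999 §2.2] -/
theorem determinedBy_openConnIn_compl_singleton (β x y : Fin n) :
    DeterminedBy (openConnIn ({β}ᶜ : Set (Fin n)) x y)
      (↑(Finset.univ.filter fun e : Sym2 (Fin n) => β ∈ e) : Set (Sym2 (Fin n)))ᶜ := by
  rw [determinedBy_iff]
  intro ω ω' h
  have key : (openGraph ω).induce ({β}ᶜ : Set (Fin n)) = (openGraph ω').induce ({β}ᶜ : Set (Fin n)) := by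
    ext u v
    simp only [SimpleGraph.comap_adj, Function.Embedding.coe_subtype, openGraph_adj]
    have hmem : s(u.1, v.1) ∈ (↑(Finset.univ.filter fun e : Sym2 (Fin n) => β ∈ e) : Set (Sym2 (Fin n)))ᶜ := by
      simp only [Finset.coe_filter, Finset.mem_univ, true_and, Set.mem_compl_iff, Set.mem_setOf_eq, Sym2.mem_iff,
        not_or]
      exact ⟨fun h' => u.2 h'.symm, fun h' => v.2 h'.symm⟩
    have hiff : s(u.1, v.1) ∈ ω ↔ s(u.1, v.1) ∈ ω' :=
      ⟨fun h1 => ((Set.ext_iff.1 h _).1 ⟨h1, hmem⟩).1, fun h1 => ((Set.ext_iff.1 h _).2 ⟨h1, hmem⟩).1⟩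
    rw [hiff]
  simp only [openConnIn, Set.mem_setOf_eq, key]

/-- The star event `σ_B` of `β` is determined by the pairs containing `β`. [folklore; Grimmett 1999 §2.2] -/
theorem determinedBy_starEvent (β : Fin n) (B : Set (Fin n)) :
    DeterminedBy (starEvent β B) (↑(Finset.univ.filter fun e : Sym2 (Fin n) => β ∈ e) : Set (Sym2 (Fin n))) := by
  rw [determinedBy_iff]
  intro ω ω' hωω'
  simp only [mem_starEvent_iff]
  refine forall₂_congr fun u _ => ?_
  have hmem : s(β, u) ∈ (↑(Finset.univ.filter fun e : Sym2 (Fin n) => β ∈ e) : Set (Sym2 (Fin n))) := by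
    simp
  have := Set.ext_iff.1 hωω' s(β, u)
  simp only [mem_inter_iff, hmem, and_true] at this
  rw [this]

/-- **Independence of the star**: `μ(E ∩ σ_B) = μ(σ_B) · μ(E)` for every event `E` determined by the pairs off `β`.
[folklore; Grimmett 1999 §2.2] -/
theorem real_inter_starEvent_of_determinedBy (w : Sym2 (Fin n) → unitInterval) (β : Fin n) (B : Set (Fin n))
    {E : Set (BondConfig (Fin n))}
    (hE : DeterminedBy E (↑(Finset.univ.filter fun e : Sym2 (Fin n) => β ∈ e) : Set (Sym2 (Fin n)))ᶜ) :
    (prodBernoulli w).real (E ∩ starEvent β B) = (prodBernoulli w).real (starEvent β B) * (prodBernoulli w).real E := by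
  rw [Set.inter_comm]
  exact prodBernoulli_real_inter_of_determinedBy w _ (determinedBy_starEvent β B) hE
    MeasurableSet.of_discrete MeasurableSet.of_discrete

/-! ### Closure of `DeterminedBy` under the Boolean operations used below -/

section DetBy

variable {ι : Type*} {K : Set ι}

/-- `DeterminedBy` is closed under complement. [folklore] -/
theorem detBy_compl {E : Set (Set ι)} (h : DeterminedBy E K) : DeterminedBy Eᶜ K := by
  rw [determinedBy_iff] at h ⊢
  intro ω ω' hω
  simp only [Set.mem_compl_iff, h ω ω' hω]

/-- `DeterminedBy` is closed under union. [folklore] -/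
theorem detBy_union {E E' : Set (Set ι)} (h : DeterminedBy E K) (h' : DeterminedBy E' K) : DeterminedBy (E ∪ E') K := by
  rw [determinedBy_iff] at h h' ⊢
  intro ω ω' hω
  simp only [Set.mem_union, h ω ω' hω, h' ω ω' hω]

/-- `DeterminedBy` is closed under set-builder disjunction/conjunction of finitely indexed families: bounded `∃`. [folklore] -/
theorem detBy_exists {α : Type*} (s : Finset α) {E : α → Set (Set ι)} (h : ∀ a ∈ s, DeterminedBy (E a) K) :
    DeterminedBy {ω | ∃ a ∈ s, ω ∈ E a} K := by
  rw [determinedBy_iff]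
  intro ω ω' hω
  simp only [Set.mem_setOf_eq]
  exact exists_congr fun a => and_congr_right fun ha => (determinedBy_iff _ _).1 (h a ha) ω ω' hω

/-- … and bounded `∀`. [folklore] -/
theorem detBy_forall {α : Type*} (s : Finset α) {E : α → Set (Set ι)} (h : ∀ a ∈ s, DeterminedBy (E a) K) :
    DeterminedBy {ω | ∀ a ∈ s, ω ∈ E a} K := by
  rw [determinedBy_iff]
  intro ω ω' hω
  simp only [Set.mem_setOf_eq]
  exact forall₂_congr fun a ha => (determinedBy_iff _ _).1 (h a ha) ω ω' hω

end DetBy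

/-! ### The star expansion of the T-functional -/

/-- **Star expansion of `μ(β ↮ A)`**: `μ(β ↮ A) = Σ_B μ(σ_B)·μ(∀ u ∈ B, ∀ a ∈ A, ¬ u ↔ a off β)` (`β ∉ A`).
[cite: KozmaNitzan2024, §3.2 pp. 13–14] -/
theorem real_notConnA_starExpansion (w : Sym2 (Fin n) → unitInterval) (A : Finset (Fin n)) (β : Fin n) (hβ : β ∉ A) :
    (prodBernoulli w).real {ω : BondConfig (Fin n) | ∀ a ∈ A, ¬ (openGraph ω).Reachable β a} =
      ∑ B ∈ (Finset.univ.erase β).powerset, (prodBernoulli w).real (starEvent β (↑B : Set (Fin n))) *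
        (prodBernoulli w).real {ω : BondConfig (Fin n) | ∀ u ∈ B, ∀ a ∈ A, ω ∉ openConnIn ({β}ᶜ : Set (Fin n)) u a} := by
  rw [real_eq_sum_inter_starEvent w (Finset.univ.erase β) β (Finset.notMem_erase β _)
    (fun u hu huA => (huA (Finset.mem_erase.2 ⟨hu, Finset.mem_univ u⟩)).elim)]
  refine Finset.sum_congr rfl fun B hB => ?_
  have hβB : β ∉ B := fun h => Finset.notMem_erase β Finset.univ (Finset.mem_powerset.1 hB h)
  have hset : {ω : BondConfig (Fin n) | ∀ a ∈ A, ¬ (openGraph ω).Reachable β a} ∩ starEvent β ↑B =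
      {ω : BondConfig (Fin n) | ∀ u ∈ B, ∀ a ∈ A, ω ∉ openConnIn ({β}ᶜ : Set (Fin n)) u a} ∩ starEvent β ↑B := by
    ext ω
    simp only [Set.mem_inter_iff, Set.mem_setOf_eq]
    constructor
    · rintro ⟨h, hσ⟩
      refine ⟨fun u hu a ha hua => h a ha ?_, hσ⟩
      exact (reachable_center_iff_of_starEvent hβB hσ (fun h' => hβ (h' ▸ ha))).2 ⟨u, hu, hua⟩
    · rintro ⟨h, hσ⟩
      refine ⟨fun a ha hβa => ?_, hσ⟩
      obtain ⟨u, hu, hua⟩ := (reachable_center_iff_of_starEvent hβB hσ (fun h' => hβ (h' ▸ ha))).1 hβa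
      exact h u hu a ha hua
  rw [hset, real_inter_starEvent_of_determinedBy]
  exact detBy_forall B fun u _ => detBy_forall A fun a _ =>
    detBy_compl (determinedBy_openConnIn_compl_singleton β u a)

/-- **Star expansion of `μ(β ↔ b)`**: `μ(β ↔ b) = Σ_B μ(σ_B)·μ(∃ u ∈ B, u ↔ b off β)` (`b ≠ β`).
[cite: KozmaNitzan2024, §3.2 pp. 13–14] -/
theorem real_openConn_center_starExpansion (w : Sym2 (Fin n) → unitInterval) (β b : Fin n) (hb : b ≠ β) :
    (prodBernoulli w).real (openConn β b) =
      ∑ B ∈ (Finset.univ.erase β).powerset, (prodBernoulli w).real (starEvent β (↑B : Set (Fin n))) *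
        (prodBernoulli w).real {ω : BondConfig (Fin n) | ∃ u ∈ B, ω ∈ openConnIn ({β}ᶜ : Set (Fin n)) u b} := by
  rw [real_eq_sum_inter_starEvent w (Finset.univ.erase β) β (Finset.notMem_erase β _)
    (fun u hu huA => (huA (Finset.mem_erase.2 ⟨hu, Finset.mem_univ u⟩)).elim)]
  refine Finset.sum_congr rfl fun B hB => ?_
  have hβB : β ∉ B := fun h => Finset.notMem_erase β Finset.univ (Finset.mem_powerset.1 hB h)
  have hset : (openConn β b : Set (BondConfig (Fin n))) ∩ starEvent β ↑B =
      {ω : BondConfig (Fin n) | ∃ u ∈ B, ω ∈ openConnIn ({β}ᶜ : Set (Fin n)) u b} ∩ starEvent β ↑B := by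
    ext ω
    simp only [Set.mem_inter_iff, Set.mem_setOf_eq]
    constructor
    · rintro ⟨h, hσ⟩; exact ⟨(reachable_center_iff_of_starEvent hβB hσ hb).1 h, hσ⟩
    · rintro ⟨h, hσ⟩; exact ⟨(reachable_center_iff_of_starEvent hβB hσ hb).2 h, hσ⟩
  rw [hset, real_inter_starEvent_of_determinedBy]
  exact detBy_exists B fun u _ => determinedBy_openConnIn_compl_singleton β u b

/-- **Star expansion of `μ(d ↔ b)` at a third vertex `β`**: `μ(d ↔ b) = Σ_B μ(σ_B)·μ(d ↔ b off β ∨ (d ↔ B off β ∧ B ↔ b off β))`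
(`d, b ≠ β`). [cite: KozmaNitzan2024, §3.2 pp. 13–14] -/
theorem real_openConn_starExpansion (w : Sym2 (Fin n) → unitInterval) (β d b : Fin n) (hd : d ≠ β) (hb : b ≠ β) :
    (prodBernoulli w).real (openConn d b) =
      ∑ B ∈ (Finset.univ.erase β).powerset, (prodBernoulli w).real (starEvent β (↑B : Set (Fin n))) *
        (prodBernoulli w).real ((openConnIn ({β}ᶜ : Set (Fin n)) d b : Set (BondConfig (Fin n))) ∪
          ({ω | ∃ u ∈ B, ω ∈ openConnIn ({β}ᶜ : Set (Fin n)) d u} ∩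
            {ω | ∃ u ∈ B, ω ∈ openConnIn ({β}ᶜ : Set (Fin n)) u b})) := by
  rw [real_eq_sum_inter_starEvent w (Finset.univ.erase β) β (Finset.notMem_erase β _)
    (fun u hu huA => (huA (Finset.mem_erase.2 ⟨hu, Finset.mem_univ u⟩)).elim)]
  refine Finset.sum_congr rfl fun B hB => ?_
  have hβB : β ∉ B := fun h => Finset.notMem_erase β Finset.univ (Finset.mem_powerset.1 hB h)
  have hset : (openConn d b : Set (BondConfig (Fin n))) ∩ starEvent β ↑B =
      ((openConnIn ({β}ᶜ : Set (Fin n)) d b : Set (BondConfig (Fin n))) ∪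
          ({ω | ∃ u ∈ B, ω ∈ openConnIn ({β}ᶜ : Set (Fin n)) d u} ∩
            {ω | ∃ u ∈ B, ω ∈ openConnIn ({β}ᶜ : Set (Fin n)) u b})) ∩ starEvent β ↑B := by
    ext ω
    simp only [Set.mem_inter_iff, Set.mem_union, Set.mem_setOf_eq]
    constructor
    · rintro ⟨h, hσ⟩; exact ⟨(reachable_iff_of_starEvent hβB hσ hd hb).1 h, hσ⟩
    · rintro ⟨h, hσ⟩; exact ⟨(reachable_iff_of_starEvent hβB hσ hd hb).2 h, hσ⟩
  rw [hset, real_inter_starEvent_of_determinedBy]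
  exact detBy_union (determinedBy_openConnIn_compl_singleton β d b)
    ((detBy_exists B fun u _ => determinedBy_openConnIn_compl_singleton β d u).inter
      (detBy_exists B fun u _ => determinedBy_openConnIn_compl_singleton β u b))

/-- **The T-form star expansion** (exact, pocket-free).  For `β ∉ A`, `b ∈ A`, `d ≠ β`:
`μ(β ↮ A) + μ(β ↔ b) − μ(d ↔ b) = Σ_{B ⊆ V∖β} μ(σ_B) · [ μ(∀ u∈B ∀ a∈A: ¬ u ↔ a off β) + μ(∃ u∈B: u ↔ b off β) − μ(d ↔ b off β ∨ (d ↔ B ∧ B ↔ b off β)) ]`.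
The bracket is the T-functional of the glued block `[B]` in the graph with `β` deleted; for `B = ∅` it equals `1 − μ(d ↔ b off β) ≥ 0`.
[cite: KozmaNitzan2024, §3.2 pp. 12–14] -/
theorem T_starExpansion (w : Sym2 (Fin n) → unitInterval) (A : Finset (Fin n)) (β d b : Fin n)
    (hβ : β ∉ A) (hb : b ∈ A) (hd : d ≠ β) :
    (prodBernoulli w).real {ω : BondConfig (Fin n) | ∀ a ∈ A, ¬ (openGraph ω).Reachable β a} +
        (prodBernoulli w).real (openConn β b) - (prodBernoulli w).real (openConn d b) =
      ∑ B ∈ (Finset.univ.erase β).powerset, (prodBernoulli w).real (starEvent β (↑B : Set (Fin n))) *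
        ((prodBernoulli w).real {ω : BondConfig (Fin n) | ∀ u ∈ B, ∀ a ∈ A, ω ∉ openConnIn ({β}ᶜ : Set (Fin n)) u a} +
          (prodBernoulli w).real {ω : BondConfig (Fin n) | ∃ u ∈ B, ω ∈ openConnIn ({β}ᶜ : Set (Fin n)) u b} -
          (prodBernoulli w).real ((openConnIn ({β}ᶜ : Set (Fin n)) d b : Set (BondConfig (Fin n))) ∪
            ({ω | ∃ u ∈ B, ω ∈ openConnIn ({β}ᶜ : Set (Fin n)) d u} ∩
              {ω | ∃ u ∈ B, ω ∈ openConnIn ({β}ᶜ : Set (Fin n)) u b}))) := by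
  have hbβ : b ≠ β := fun h => hβ (h ▸ hb)
  rw [real_notConnA_starExpansion w A β hβ, real_openConn_center_starExpansion w β b hbβ,
    real_openConn_starExpansion w β d b hd hbβ, ← Finset.sum_add_distrib, ← Finset.sum_sub_distrib]
  refine Finset.sum_congr rfl fun B _ => ?_
  ring

/-- Registered rung `stub_TstarExpansion_b` of crux stmt-CriticalPhenomena-4576 (seat b): the T-form star expansion —
`T_starExpansion`, closed statement. [cite: KozmaNitzan2024, §3.2 pp. 12–14] -/
theorem stub_TstarExpansion_b : ∀ (n : ℕ) (w : Sym2 (Fin n) → unitInterval) (A : Finset (Fin n)) (β d b : Fin n), β ∉ A → b ∈ A → d ≠ β → (Literature.Probability.LatticeModels.prodBernoulli w).real {ω : Literature.Probability.Percolation.BondConfig (Fin n) | ∀ a ∈ A, ¬ (Literature.Probability.Percolation.openGraph ω).Reachable β a} + (Literature.Probability.LatticeModels.prodBernoulli w).real (Literature.Probability.Percolation.openConn β b) - (Literature.Probability.LatticeModels.prodBernoulli w).real (Literature.Probability.Percolation.openConn d b) = ∑ B ∈ (Finset.univ.erase β).powerset, (Literature.Probability.LatticeModels.prodBernoulli w).real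 (Literature.Probability.Percolation.starEvent β (↑B : Set (Fin n))) * ((Literature.Probability.LatticeModels.prodBernoulli w).real {ω : Literature.Probability.Percolation.BondConfig (Fin n) | ∀ u ∈ B, ∀ a ∈ A, ω ∉ Literature.Probability.Percolation.openConnIn ({β}ᶜ : Set (Fin n)) u a} + (Literature.Probability.LatticeModels.prodBernoulli w).real {ω : Literature.Probability.Percolation.BondConfig (Fin n) | ∃ u ∈ B, ω ∈ Literature.Probability.Percolation.openConnIn ({β}ᶜ : Set (Fin n)) u b} - (Literature.Probability.LatticeModels.prodBernoulli w).real ((Literature.Probability.Percolation.openConnIn ({β}ᶜ : Set (Fin n)) d b : Set (Literature.Probability.Percolation.BondConfig (Fin n))) ∪ ({ω | ∃ u ∈ B, ω ∈ Literature.Probability.Percolation.openConnIn ({β}ᶜ : Set (Fin n)) d u} ∩ {ω | ∃ u ∈ B, ω ∈ Literature.Probability.Percolation.openConnIn ({β}ᶜ : Set (Fin n)) u b}))) :=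
  fun _ w A β d b hβ hb hd => T_starExpansion w A β d b hβ hb hd

end TStarExpansion

end

end Summit.CriticalPhenomena.PercolationContinuityZ3.Theorems
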